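import Literature.NumberTheory.EllipticCurves.CasselsTateSelmerFirstCase
import Literature.NumberTheory.EllipticCurves.CasselsTateSelmerPullback
import HarnessLib

/-!
# The pulled-back Cassels–Tate pairing on an `m`-fold multiple and a class supported at one place

Topic `NumberTheory/EllipticCurves`; namespace `Literature.NumberTheory.EllipticCurves`. Theorems only:
**no definition and no named fact is introduced** (D-0026). Sequel of `CasselsTateSelmerFirstCase`
(first case of Milne's construction on `m • b₁`, single-place reduction) and `CasselsTateSelmerPullback`
(the level-`m` pairing pulled back to `Sel^{(m²)}(E/K)` along `ι : Sel^{(m²)} → Ш[m]`).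

This file is McCallum's Prop. 4.7 (*"`⟨d_M(n), d⟩ = ∑_{λ ∣ n} ⟨d_M(n)_λ, y_λ⟩_λ`"*, §4, PDF p. 284) in
the form consumed by Kolyvagin's descent at level `M = 2M₀`, `m = p^{M₀}` (the pairing `P` on
`Sel = S_{p^M}(E/K)` of McCallum's Thm. 5.4): for Selmer classes `z, t ∈ Sel^{(m²)}(E/K)` with

* `z = m • b₁` for a GIVEN `b₁ ∈ H¹(K, E[m²])` (Kolyvagin: `z = p^j c_M(n)`, `b₁ = p^{j-M₀} c_M(n)`),
* `[m]_* t = 0` (Kolyvagin: `p^N t = 0` with `N ≤ M₀`, and `E(K)[p] = 0`: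
  `map_mulK_eq_zero_of_zsmul_eq_zero`), so that `t = ι_* b'` for a level-`m` Selmer class `b'`
  (`exists_selmer_inclKD_lift`),
* and a place `v₀` such that at every other place either `loc_v b₁` satisfies the local Kummer
  condition (Kolyvagin: `v ∤ n`, McCallum Lemma 4.3) or `loc_v t = 0` AND `ι_*` is injective on
  `H¹(K_v, E[m])` (Kolyvagin: `v ∣ n/ℓ`, where `t_v = 0` and `E[p^M] ⊆ E(K_v)`:
  `map_inclKD_restrictField_injective_of_forall_smul_eq`),

the value `P(z, t) = B(ι z, ι t)` of the pulled-back level-`m` Cassels–Tate pairing is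
`zmodToCircle (m²)` of the SINGLE local term at `v₀` of any first-case data `D` with `D.b₁ = b₁`,
`ι_* D.b' = t` (`ctLevelPairing_pullback_eq_localTerm`; such data exist,
`exists_firstCaseData_of_zsmul_of_map_mulK_eq_zero`). What then remains of McCallum's value formula
(his Lemma 5.3: the term at `v₀ = λ` is non-zero when the local orders multiply to more than `p^M`) is
a purely LOCAL statement about `inv_λ((loc_λ b₁ - β_λ) ∪ β'_λ)`.

Also: `map_inclKD_map_mulK` (`ι_* [m]_* = m`), `map_inclKD_injective_of_forall_fixed_eq_zero`
(`E(K)[m] = 0 ⟹ ι_*` injective on `H¹(K, E[m])`), their local versions. All Cassels–Tate hypotheses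
are those of the tree (`halt`, `hPT'`, `hH3`, `hfin` of `ctLevelPairing`); no new input.

## References

* [McCallumLMS1991] W. G. McCallum, *Kolyvagin's work on Shafarevich–Tate groups*, LMS Lecture Note
  Ser. 153 (1991), §2 (1), §4 Lemma 4.3, Prop. 4.7, §5 Lemma 5.3, Thm. 5.4.
* [MilneADT2006] J. S. Milne, *Arithmetic Duality Theorems*, 2nd ed. (2006), Ch. I §6, proof of
  Prop. 6.9.
* [SerreGaloisCohomology1997] J.-P. Serre, *Galois Cohomology* (1997), I §2.2.
-/

noncomputable section

open scoped Classical
open scoped AddSubgroup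

universe u

namespace Literature.NumberTheory.EllipticCurves

open CategoryTheory _root_.WeierstrassCurve Field Function NumberField
open Literature.NumberTheory.GaloisRepresentations Literature.NumberTheory.GaloisCohomology
open Literature.NumberTheory.GaloisRepresentations.DiscreteGaloisModule (mu MuCarrier pairing)
open Literature.GroupTheory.FiniteAbelian
open scoped ContRepresentation

-- Cup products need `LocallyCompactSpace Γ`; as in the tree's cup-product files, the compactness of
-- absolute Galois groups is a local instance only.
attribute [local instance] absoluteGaloisGroup_compactSpace

-- `char K_v = 0` for the completions of a number field (local instance, no override).
attribute [local instance] charZero_placeCompletion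

/-! ## `ι_* ∘ [m]_* = m` and the injectivity of `ι_*` -/

section InclKD

variable {K : Type u} [Field K] (W : WeierstrassCurve K) (m : ℕ)

/-- `ι_* ([m]_* y) = m • y` on `H¹(K, E[m²])` (`ι ∘ [m] = m` on `E[m²]`, tree `inclKD_mulK`).
[cite: MilneADT2006, Ch. I §6, proof of Prop. 6.9] -/
theorem map_inclKD_map_mulK (y : galoisCohomology (W.torsionGaloisModule ((m * m : ℕ) : ℤ)) 1) :
    galoisCohomology.map (inclKD W m m) 1 (galoisCohomology.map (mulK W m m) 1 y) = (m : ℤ) • y := by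
  obtain ⟨ψ, rfl⟩ := oneCocycleClass_surjective _ y
  rw [galoisCohomology.map_one_oneCocycleClass, galoisCohomology.map_one_oneCocycleClass]
  have key : ∀ (A B : contOneCocycles (W.torsionGaloisModule ((m * m : ℕ) : ℤ)).toTopRep),
      A = (m : ℤ) • B →
      (oneCocycleClass _ A : galoisCohomology (W.torsionGaloisModule ((m * m : ℕ) : ℤ)) 1) =
        (m : ℤ) • (oneCocycleClass _ B : galoisCohomology (W.torsionGaloisModule ((m * m : ℕ) : ℤ)) 1) := by
    rintro A B rfl
    exact (oneCocycleClass_smul _ (m : ℤ) _).trans (Int.cast_smul_eq_zsmul ℤ (m : ℤ) _)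
  refine key _ _ (Subtype.ext (ContinuousMap.ext fun σ => ?_))
  change inclKD W m m (mulK W m m (ψ.1 σ)) = (m : ℤ) • ψ.1 σ
  rw [inclKD_mulK, natCast_zsmul]

/-- The same over any `K`-field `F` (restricted level maps). [cite: MilneADT2006, Ch. I §6, proof of Prop. 6.9] -/
theorem map_inclKD_map_mulK_restrictField (F : Type u) [Field F] [Algebra K F]
    (y : galoisCohomology (GaloisRep.restrictField F (W.torsionGaloisModule ((m * m : ℕ) : ℤ))) 1) :
    galoisCohomology.map ((inclKD W m m).restrictField F) 1
        (galoisCohomology.map ((mulK W m m).restrictField F) 1 y) = (m : ℤ) • y := by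
  obtain ⟨ψ, rfl⟩ := oneCocycleClass_surjective _ y
  rw [galoisCohomology.map_one_oneCocycleClass, galoisCohomology.map_one_oneCocycleClass]
  have key : ∀ (A B : contOneCocycles
      (GaloisRep.restrictField F (W.torsionGaloisModule ((m * m : ℕ) : ℤ))).toTopRep),
      A = (m : ℤ) • B →
      (oneCocycleClass _ A :
          galoisCohomology (GaloisRep.restrictField F (W.torsionGaloisModule ((m * m : ℕ) : ℤ))) 1) =
        (m : ℤ) • (oneCocycleClass _ B :
          galoisCohomology (GaloisRep.restrictField F (W.torsionGaloisModule ((m * m : ℕ) : ℤ))) 1) := by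
    rintro A B rfl
    exact (oneCocycleClass_smul _ (m : ℤ) _).trans (Int.cast_smul_eq_zsmul ℤ (m : ℤ) _)
  refine key _ _ (Subtype.ext (ContinuousMap.ext fun σ => ?_))
  change inclKD W m m (mulK W m m (ψ.1 σ)) = (m : ℤ) • ψ.1 σ
  rw [inclKD_mulK, natCast_zsmul]

variable [CharZero K] [NeZero m]

/-- **`ι_* : H¹(K, E[m]) → H¹(K, E[m²])` is injective when `E(K)[m] = 0`** (more precisely when
`E[m]` has no non-zero `Γ_K`-fixed point): its kernel is the image of the connecting map
`δ₀ : E[m]^{Γ_K} → H¹(K, E[m])` of `0 → E[m] → E[m²] → E[m] → 0` (tree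
`IsSES.exists_δ₀_eq_of_map_one_eq_zero`). [cite: SerreGaloisCohomology1997, I §2.2] -/
theorem map_inclKD_injective_of_forall_fixed_eq_zero
    (hfix : ∀ P : geomTorsion W (m : ℤ), (∀ σ : absoluteGaloisGroup K, σ • P = P) → P = 0) :
    Injective (galoisCohomology.map (inclKD W m m) 1) := by
  rw [injective_iff_map_eq_zero]
  intro x hx
  obtain ⟨v, hv⟩ := (torsion_isSES_nat W m).exists_δ₀_eq_of_map_one_eq_zero x hx
  have hv0 : v = 0 := Subtype.ext (hfix v.1 fun σ => v.2 σ)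
  rw [hv0, map_zero] at hv
  exact hv.symm

/-- Hence **`[m]_* y = 0` for every `y ∈ H¹(K, E[m²])` with `m • y = 0`**, when `E(K)[m] = 0`
(`ι_* [m]_* y = m • y = 0` and `ι_*` is injective). In Kolyvagin's descent: a class `t` of
`H¹(K, E[p^{2M₀}])` killed by `p^N`, `N ≤ M₀`, is killed by `[p^{M₀}]_*` (`E(K)[p] = 0`).
[cite: McCallumLMS1991, §5 Thm. 5.4 (proof)] [cite: SerreGaloisCohomology1997, I §2.2] -/
theorem map_mulK_eq_zero_of_zsmul_eq_zero
    (hfix : ∀ P : geomTorsion W (m : ℤ), (∀ σ : absoluteGaloisGroup K, σ • P = P) → P = 0)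
    {y : galoisCohomology (W.torsionGaloisModule ((m * m : ℕ) : ℤ)) 1} (hy : (m : ℤ) • y = 0) :
    galoisCohomology.map (mulK W m m) 1 y = 0 :=
  map_inclKD_injective_of_forall_fixed_eq_zero W m hfix (by rw [map_inclKD_map_mulK, hy, map_zero])

/-- **`ι_* : H¹(F, E[m]) → H¹(F, E[m²])` is injective over a `K`-field `F` whose Galois group acts
trivially on `E[m²]`** (e.g. `F = K_λ` at a Kolyvagin prime of level `m²`): then
`[m] : E[m²]^{Γ_F} = E[m²] → E[m] = E[m]^{Γ_F}` is onto, so the connecting map `δ₀` vanishes (tree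
`IsSES.δ₀_eq_zero_iff`). [cite: SerreGaloisCohomology1997, I §2.2] [cite: McCallumLMS1991, §4 Prop. 4.7] -/
theorem map_inclKD_restrictField_injective_of_forall_smul_eq (F : Type u) [Field F] [Algebra K F]
    (htriv : ∀ (g : absoluteGaloisGroup F) (P : geomTorsion W ((m * m : ℕ) : ℤ)),
      absGaloisRestrict K F g • P = P) :
    Injective (galoisCohomology.map ((inclKD W m m).restrictField F) 1) := by
  rw [injective_iff_map_eq_zero]
  intro x hx
  have hS := (torsion_isSES_nat W m).restrictField F
  obtain ⟨v, hv⟩ := hS.exists_δ₀_eq_of_map_one_eq_zero x hx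
  have hv0 : hS.δ₀ v = 0 := by
    rw [hS.δ₀_eq_zero_iff]
    obtain ⟨w, hw⟩ := mulK_surjective W m m v.1
    exact ⟨w, fun g => htriv g w, by rw [DiscreteGaloisModule.resFieldHom_apply]; exact hw⟩
  rw [← hv, hv0]
  rfl

end InclKD

/-! ## The Selmer lift at level `m` of the second argument -/

section Lift

variable {K : Type u} [Field K] [NumberField K] (W : WeierstrassCurve K) (m : ℕ) [NeZero m]

/-- **A level-`m²` Selmer class killed by `[m]_*` is `ι_*` of a level-`m` Selmer class** with the
same image in `H¹(K, E)` (exactness of `H¹(K, E[m]) → H¹(K, E[m²]) → H¹(K, E[m])` and the Selmer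
conditions, `CasselsTateSelmerFirstCase`). [cite: MilneADT2006, Ch. I §6, proof of Prop. 6.9] -/
theorem exists_selmer_inclKD_lift [W.IsElliptic]
    {t : galoisCohomology (W.torsionGaloisModule ((m * m : ℕ) : ℤ)) 1}
    (ht : t ∈ selmerGroup W ((m * m : ℕ) : ℤ)) (hmt : galoisCohomology.map (mulK W m m) 1 t = 0) :
    ∃ b' : galoisCohomology (W.torsionGaloisModule (m : ℤ)) 1, b' ∈ selmerGroup W (m : ℤ) ∧
      galoisCohomology.map (inclKD W m m) 1 b' = t ∧
      torsionH1ToH1 W (m : ℤ) b' = torsionH1ToH1 W ((m * m : ℕ) : ℤ) t := by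
  obtain ⟨b', rfl⟩ := exists_map_inclKD_eq_of_map_mulK_eq_zero_global W m hmt
  exact ⟨b', mem_selmerGroup_of_map_inclKD_mem W m ht, rfl, (torsionH1ToH1_map_inclKD W m b').symm⟩

/-- **First-case data for `(m • b₁, t)`** with `D.b₁ = b₁` and `ι_* D.b' = t`, for `b₁ ∈ H¹(K, E[m²])`
with `m • b₁` Selmer and a level-`m²` Selmer `t` killed by `[m]_*`.
[cite: MilneADT2006, Ch. I §6, proof of Prop. 6.9] -/
theorem exists_firstCaseData_of_zsmul_of_map_mulK_eq_zero [W.IsElliptic]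
    {b₁ : galoisCohomology (W.torsionGaloisModule ((m * m : ℕ) : ℤ)) 1}
    (hb₁ : (m : ℤ) • b₁ ∈ selmerGroup W ((m * m : ℕ) : ℤ))
    {t : galoisCohomology (W.torsionGaloisModule ((m * m : ℕ) : ℤ)) 1}
    (ht : t ∈ selmerGroup W ((m * m : ℕ) : ℤ)) (hmt : galoisCohomology.map (mulK W m m) 1 t = 0) :
    ∃ D : FirstCaseData W m, D.b₁ = b₁ ∧ galoisCohomology.map (inclKD W m m) 1 D.b' = t := by
  obtain ⟨b', hb', hb't, -⟩ := exists_selmer_inclKD_lift W m ht hmt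
  obtain ⟨D, -, hD₁, hD'⟩ := FirstCaseData.exists_of_zsmul_mem hb₁ hb'
  exact ⟨D, hD₁, by rw [hD', hb't]⟩

end Lift

/-! ## The pulled-back pairing on `(m • b₁, t)` is one local term -/

section Value

variable {K : Type u} [Field K] [NumberField K] {W : WeierstrassCurve K} {m : ℕ} [NeZero m]
variable (e : geomTorsion W ((m * m : ℕ) : ℤ) → geomTorsion W ((m * m : ℕ) : ℤ) → AlgebraicClosure K)
  (hμ : ∀ S T, e S T ^ (m * m) = 1)
  (hadd₁ : ∀ S₁ S₂ T, e (S₁ + S₂) T = e S₁ T * e S₂ T)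
  (hadd₂ : ∀ S T₁ T₂, e S (T₁ + T₂) = e S T₁ * e S T₂)
  (hgal : ∀ (σ : absoluteGaloisGroup K) (S T : geomTorsion W ((m * m : ℕ) : ℤ)),
    σ • e S T = e (σ • S) (σ • T))
variable (inv : LocalInvariants K (m * m))
-- `hPT'` is the reciprocity predicate `LocalInvariants.SumInvLocalizationEqZero` on `inv`, not a named fact.
variable (halt : ∀ T, e T T = 1) (hPT' : inv.SumInvLocalizationEqZero)
  (hH3 : ∀ c : galoisCohomology (mu K (m * m)) 3,
    (∀ v : Place K, galoisCohomology.localization (mu K (m * m)) v 3 c = 0) → c = 0)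
  (hfin : ∀ D : GeneralCaseData W m e hμ hadd₁ hadd₂ hgal, ∃ S : Finset (Place K), ∀ v ∉ S, D.localTerm inv v = 0)
variable (ι : selmerGroup W ((m * m : ℕ) : ℤ) →+ (W.sha)[m])
  (hι : ∀ z, shaTorsionVal W m (ι z) = torsionH1ToH1 W ((m * m : ℕ) : ℤ) z)

omit [NeZero m] in
/-- For first-case data with `ι_* D.b' = t`: at a place where `loc_v t = 0` and `ι_*` is injective on
`H¹(K_v, E[m])`, `loc_v D.b' = 0`. [cite: McCallumLMS1991, §4 Prop. 4.7] -/
theorem FirstCaseData.res_b'_eq_zero_of_map_inclKD_eq (D : FirstCaseData W m)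
    {t : galoisCohomology (W.torsionGaloisModule ((m * m : ℕ) : ℤ)) 1}
    (hDt : galoisCohomology.map (inclKD W m m) 1 D.b' = t) {v : Place K}
    (htv : galoisCohomology.res (W.torsionGaloisModule ((m * m : ℕ) : ℤ)) (Place.Completion v) 1 t = 0)
    (hinj : Injective (galoisCohomology.map ((inclKD W m m).restrictField (Place.Completion v)) 1)) :
    galoisCohomology.res (W.torsionGaloisModule (m : ℤ)) (Place.Completion v) 1 D.b' = 0 := by
  apply hinj
  rw [map_zero, ← galoisCohomology.res_map_one, hDt, htv]

include halt hPT' hι in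
/-- **McCallum's Prop. 4.7 with one surviving term, for the pulled-back level-`m` Cassels–Tate pairing.**
Let `z, t ∈ Sel^{(m²)}(E/K)` with `z = m • b₁` (`b₁ ∈ H¹(K, E[m²])` given), let `D` be first-case data
with `D.b₁ = b₁` and `ι_* D.b' = t`, and let `v₀` be a place such that at every place `v ≠ v₀` either
`loc_v b₁` lies in the local Kummer condition at level `m²`, or `loc_v t = 0` and `ι_*` is injective on
`H¹(K_v, E[m])`. Then `B(ι z, ι t) = zmodToCircle (m²) (inv_{v₀}((loc_{v₀} b₁ - β_{v₀}) ∪ β'_{v₀}))`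
for `B = ctLevelPairing` (pulled back along `ι : Sel^{(m²)} → Ш[m]`, `CasselsTateSelmerPullback`).
In Kolyvagin's descent (`M = 2M₀`, `m = p^{M₀}`, `z = p^j c_M(ℓm')`, `b₁ = p^{j-M₀} c_M(ℓm')`, `t`
vanishing at the primes of `m'`, `v₀ = λ`) this is *"`⟨d_{M-j}(n), d⟩ = ⟨d(n)_λ, y_λ⟩_λ`"*.
[cite: McCallumLMS1991, §4 Prop. 4.7] [cite: MilneADT2006, Ch. I §6, proof of Prop. 6.9] -/
theorem ctLevelPairing_pullback_eq_localTerm [W.IsElliptic] (z t : selmerGroup W ((m * m : ℕ) : ℤ))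
    {b₁ : galoisCohomology (W.torsionGaloisModule ((m * m : ℕ) : ℤ)) 1}
    (hz : (z : galH1Torsion W ((m * m : ℕ) : ℤ)) = (m : ℤ) • b₁)
    (D : FirstCaseData W m) (hD₁ : D.b₁ = b₁)
    (hDt : galoisCohomology.map (inclKD W m m) 1 D.b' = (t : galH1Torsion W ((m * m : ℕ) : ℤ)))
    (v₀ : Place K)
    (h : ∀ v : Place K, v ≠ v₀ →
      galoisCohomology.res (W.torsionGaloisModule ((m * m : ℕ) : ℤ)) (Place.Completion v) 1 b₁ ∈
          W.kummerLocalConditionAt ((m * m : ℕ) : ℤ) (Place.Completion v) ∨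
        (galoisCohomology.res (W.torsionGaloisModule ((m * m : ℕ) : ℤ)) (Place.Completion v) 1
            (t : galH1Torsion W ((m * m : ℕ) : ℤ)) = 0 ∧
          Injective (galoisCohomology.map ((inclKD W m m).restrictField (Place.Completion v)) 1))) :
    ctLevelPairing W m e hμ hadd₁ hadd₂ hgal inv halt hPT' hH3 hfin (ι z) (ι t) =
      zmodToCircle (m * m) (D.localTerm e hμ hadd₁ hadd₂ hgal inv v₀) := by
  rw [ctLevelPairing_pullback_apply e hμ hadd₁ hadd₂ hgal inv halt hPT' hH3 hfin ι hι, hz, ← hDt,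
    torsionH1ToH1_map_inclKD, ← hD₁]
  refine congrArg _ (ctGeneralFun_zsmul_eq_localTerm inv halt hPT' D v₀ fun v hv => ?_)
  rcases h v hv with h₁ | ⟨h₂, hinj⟩
  · exact Or.inl (hD₁ ▸ h₁)
  · exact Or.inr (D.res_b'_eq_zero_of_map_inclKD_eq hDt h₂ hinj)

include halt hPT' hι in
/-- **Non-vanishing form**: under the hypotheses of `ctLevelPairing_pullback_eq_localTerm`, the
pulled-back Cassels–Tate value `B(ι z, ι t)` is non-zero iff the single local term at `v₀` is non-zero
(`zmodToCircle` is injective) — the shape in which McCallum's Lemma 5.3 enters the proof of his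
Thm. 5.4 (*"pair nontrivially … if their orders multiply to more than `p^M`"*).
[cite: McCallumLMS1991, §5 Lemma 5.3, Thm. 5.4 (proof)] -/
theorem ctLevelPairing_pullback_ne_zero_iff_localTerm [W.IsElliptic]
    (z t : selmerGroup W ((m * m : ℕ) : ℤ))
    {b₁ : galoisCohomology (W.torsionGaloisModule ((m * m : ℕ) : ℤ)) 1}
    (hz : (z : galH1Torsion W ((m * m : ℕ) : ℤ)) = (m : ℤ) • b₁)
    (D : FirstCaseData W m) (hD₁ : D.b₁ = b₁)
    (hDt : galoisCohomology.map (inclKD W m m) 1 D.b' = (t : galH1Torsion W ((m * m : ℕ) : ℤ)))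
    (v₀ : Place K)
    (h : ∀ v : Place K, v ≠ v₀ →
      galoisCohomology.res (W.torsionGaloisModule ((m * m : ℕ) : ℤ)) (Place.Completion v) 1 b₁ ∈
          W.kummerLocalConditionAt ((m * m : ℕ) : ℤ) (Place.Completion v) ∨
        (galoisCohomology.res (W.torsionGaloisModule ((m * m : ℕ) : ℤ)) (Place.Completion v) 1
            (t : galH1Torsion W ((m * m : ℕ) : ℤ)) = 0 ∧
          Injective (galoisCohomology.map ((inclKD W m m).restrictField (Place.Completion v)) 1))) :
    ctLevelPairing W m e hμ hadd₁ hadd₂ hgal inv halt hPT' hH3 hfin (ι z) (ι t) ≠ 0 ↔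
      D.localTerm e hμ hadd₁ hadd₂ hgal inv v₀ ≠ 0 := by
  rw [ctLevelPairing_pullback_eq_localTerm e hμ hadd₁ hadd₂ hgal inv halt hPT' hH3 hfin ι hι z t hz
    D hD₁ hDt v₀ h]
  exact not_congr ⟨fun h0 => zmodToCircle_injective _ (h0.trans (map_zero _).symm),
    fun h0 => by rw [h0, map_zero]⟩

end Value

end Literature.NumberTheory.EllipticCurves

end
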